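import Literature.NumberTheory.Sieve.SmoothMajorantMain
import HarnessLib

/-!
# Linear equations in primes: the Goldston–Yıldırım engine with exponents `a_i = 1`, I — Euler
# factors and the Fourier expansion (Green–Tao 2010, App. D)

Trunk T-SIEVE (`Literature/NumberTheory/Sieve`), eighth file of the programme decomposing the named
fact `Literature.NumberTheory.Sieve.GreenTao2010_gowersUniformity` (B. Green, T. Tao, *Linear
equations in primes*, Ann. of Math. 171 (2010), Thm. 7.2) inline. After `…FlatOrthogonality.lean`,
Thm. 7.2 rests on `GI(s)`, `MN(s)`, two Lie-theoretic facts, and the sharp Gowers estimate (12.6),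
which the paper proves in App. D from the Goldston–Yıldırım estimate Thm. D.3 with all exponents
`a_i = 1` (`Λ♯ = -Λ_{χ♯,R,1}`). The tree's Goldston–Yıldırım engine (`SmoothMajorant*`, the
Conlon–Fox–Zhao route) treats squares `Λ_{χ,R}²` only; this file starts the `a_i = 1` engine,
following App. D of the paper (pp. 1830–1833) for a `W`-tricked system all of whose exceptional
primes divide `W`:

* `SharpGY.LocalCoeff ι W` — the local factors `α(p, B)`, `B ⊆ ι` (`α(p, ∅) = 1`; `α(p, B) = 0`
  for `p ∣ W`, `B ≠ ∅`; `α(p, {i}) = 1/p` and `α(p, B) ≤ 1/p²` for `|B| ≥ 2` when `p ∤ W`), as a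
  structure of hypotheses (verified for the cube systems in a later file from the tree's
  `primeDensity_singleton` / `primeDensity_le_of_minor`);
* `SharpGY.eulerFactor` (`E_{p,ξ}`, (D.11)), `SharpGY.eulerMain` (`E'_{p,ξ} = ∏_i (1 - p^{-1-z_i})`,
  (D.13)), `SharpGY.tupleSum` and `tupleSum_eq_prod_eulerFactor` ((D.10), from the tree's generic
  `CFZ.sum_squarefreeTuples_eq_prod`); `eulerFactor_eq_one_of_dvd`; the comparison (D.12)
  `norm_eulerFactor_sub_eulerMain_le` (`|E_p - E'_p| ≤ 2·2^{|ι|}/p²`), `half_le_norm_eulerMain`,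
  `norm_eulerFactor_div_sub_one_le`; the absolute factor `norm_eulerFactor_le`;
* the limit `Q → ∞`: `tendsto_prod_eulerMain` (`∏_p E'_p = ∏_i ζ(1+z_i)^{-1}`, footnote to
  (D.13)), `deltaSeq`, `prod_eulerFactor_eq_of_lt`, `norm_deltaSeq_le`,
  `deltaSeq_summable_and_bounds` (`‖∏'(1+δ'_q) - 1‖ ≤ e^{4·2^{|ι|}/w} - 1`, the `a = 1` case of
  Prop. D.4 for the primes `> w`), `tendsto_prod_eulerFactor`, `exists_norm_prod_eulerFactor_le`;
* the Fourier side on `ℝ^ι`: `sum_coef_prod_chi_eq_integral` (the tuple sum with the weights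
  `∏_i χ(log m_i/log R)` equals `∫ (∏_i φ(η_i)) ∏_{p ∈ P} E_p(z(η)) dη` exactly, by
  `CFZ.chi_eq_integral`), dominated convergence `tendsto_integral_prod_eulerFactor_full`, and
  `sum_coef_prod_chi_eq_integral_limit` (the eventually constant sums equal
  `∫ (∏_i φ(η_i)) (∏_i ζ(1+z_i)^{-1}/∏_{p≤w} E'_p) ∏'(1+δ'_q) dη`).

The evaluation of the last integral (main term `∏_i c_{χ,1} (W/φ(W))^{|ι|}`, `c_{χ,1} = -χ'(0)`,
Lemma D.2) is the subject of the next file.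

## References

* B. Green, T. Tao, *Linear equations in primes*, Ann. of Math. (2) 171 (2010), 1753–1850
  (arXiv:math/0606088), App. D: Def. D.1, Lemma D.2, Thm. D.3 and its proof ((D.9)–(D.13),
  Prop. D.4, Lemma D.5), and p. 1834 ("The correlation estimate for `Λ♯`").
* D. Conlon, J. Fox, Y. Zhao, *The Green–Tao theorem: an exposition*, EMS Surv. Math. Sci. 1
  (2014), §9 (the tree's `SmoothMajorant*` engine, whose Fourier and zeta lemmas are reused).
-/

noncomputable section

open Finset Complex Filter Topology
open scoped BigOperators ArithmeticFunction.Moebius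

namespace Literature.NumberTheory.Sieve.SharpGY

open Literature.NumberTheory.Sieve.CFZ

section prelim

variable {ι : Type*}

/-- `‖-p^{-z}‖ ≤ 1` for `Re z ≥ 0` (the factors `μ(p) p^{-z}` of the Euler factors). [folklore] -/
theorem norm_neg_natCast_cpow_neg_le_one {p : ℕ} (hp : 1 ≤ p) {z : ℂ} (hz : 0 ≤ z.re) :
    ‖-((p : ℂ) ^ (-z))‖ ≤ 1 := by
  rw [norm_neg, Complex.norm_natCast_cpow_of_pos (by omega)]
  exact Real.rpow_le_one_of_one_le_of_nonpos (by exact_mod_cast hp) (by simp; exact hz)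

/-- `‖p^{-(1+z)}‖ ≤ 1/p` for `Re z ≥ 0`. [folklore] -/
theorem norm_natCast_cpow_neg_one_add_le {p : ℕ} (hp : 1 ≤ p) {z : ℂ} (hz : 0 ≤ z.re) :
    ‖(p : ℂ) ^ (-(1 + z))‖ ≤ 1 / p := by
  rw [Complex.norm_natCast_cpow_of_pos (by omega)]
  have h1 : (1 : ℝ) ≤ p := by exact_mod_cast hp
  calc (p : ℝ) ^ ((-(1 + z)).re) ≤ (p : ℝ) ^ (-1 : ℝ) := by
        refine Real.rpow_le_rpow_of_exponent_le h1 ?_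
        simp only [Complex.neg_re, Complex.add_re, Complex.one_re]
        linarith
    _ = 1 / p := by rw [Real.rpow_neg_one, one_div]

/-- `∏_{i ∈ Y} (-p^{-(1+z_i)}) = p^{-|Y|} ∏_{i ∈ Y} (-p^{-z_i})`. [folklore] -/
theorem prod_neg_cpow_neg_one_add {p : ℕ} (hp : 1 ≤ p) (z : ι → ℂ) (Y : Finset ι) :
    ∏ i ∈ Y, -((p : ℂ) ^ (-(1 + z i))) = ((p : ℂ)⁻¹) ^ Y.card * ∏ i ∈ Y, -((p : ℂ) ^ (-(z i))) := by
  have hp0 : (p : ℂ) ≠ 0 := by exact_mod_cast (show p ≠ 0 by omega)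
  have h1 : ∀ i, -((p : ℂ) ^ (-(1 + z i))) = (p : ℂ)⁻¹ * -((p : ℂ) ^ (-(z i))) := by
    intro i
    rw [neg_add, Complex.cpow_add _ _ hp0, Complex.cpow_neg_one]
    ring
  rw [prod_congr rfl fun i _ => h1 i, prod_mul_distrib, prod_const]

/-- `‖∏_{i ∈ Y} (-p^{-z_i})‖ ≤ 1` for `Re z_i ≥ 0`. [folklore] -/
theorem norm_prod_neg_cpow_le_one {p : ℕ} (hp : 1 ≤ p) {z : ι → ℂ} (hz : ∀ i, 0 ≤ (z i).re)
    (Y : Finset ι) : ‖∏ i ∈ Y, -((p : ℂ) ^ (-(z i)))‖ ≤ 1 := by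
  rw [norm_prod]
  exact prod_le_one (fun _ _ => norm_nonneg _) fun i _ => by
    exact norm_neg_natCast_cpow_neg_le_one hp (hz i)

end prelim

/-! ### Local coefficient systems (the local factors `α(p, B)` of Thm. D.3 with `a_i = 1`) -/

/-- **A system of local coefficients** for the Goldston–Yıldırım estimate with exponents
`a_i = 1` (App. D of Green–Tao 2010, specialised): for each prime `p` and each set `Y` of forms,
a number `α(p, Y) ∈ [0, 1]` — in the application the density of `{n ∈ ℤ_p^d : p ∣ ψ_i(n) ∀ i ∈ Y}`
for a `W`-tricked system — with `α(p, ∅) = 1`, `α(p, Y) = 0` for `p ∣ W`, `Y ≠ ∅` (the `W`-trick),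
and, for `p ∤ W`, `α(p, {i}) = 1/p` and `α(p, Y) ≤ 1/p²` when `|Y| ≥ 2` ("If `B` is vertical then
`α(p,B) = 1/p` … `α(p,B) = O(1/p²)` whenever `B` is not vertical or empty", here with no
exceptional primes beyond those dividing `W`). [cite: GreenTao2010, App. D, proof of Thm. D.3 (the factors `α(p,B)`)] -/
structure LocalCoeff (ι : Type*) [Fintype ι] (W : ℕ) where
  /-- the local factor `α(p, Y)` -/
  g : ℕ → Finset ι → ℝ
  g_empty : ∀ p, g p ∅ = 1
  g_nonneg : ∀ p Y, 0 ≤ g p Y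
  g_le_one : ∀ p Y, g p Y ≤ 1
  g_dvd : ∀ p, p.Prime → p ∣ W → ∀ Y : Finset ι, Y.Nonempty → g p Y = 0
  g_singleton : ∀ p, p.Prime → ¬ p ∣ W → ∀ i, g p {i} = 1 / p
  g_two : ∀ p, p.Prime → ¬ p ∣ W → ∀ Y : Finset ι, 2 ≤ Y.card → g p Y ≤ 1 / (p : ℝ) ^ 2

variable {ι : Type*} [Fintype ι] {W : ℕ} (G : LocalCoeff ι W)

/-- **The Euler factor** `E_{p,ξ} = ∑_{Y ⊆ ι} (-1)^{|Y|} α(p, Y) p^{-∑_{i ∈ Y} z_i}` (display (D.11)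
with `a_i = 1`). [cite: GreenTao2010, App. D, (D.11)] -/
def eulerFactor (p : ℕ) (z : ι → ℂ) : ℂ :=
  ∑ Y : Finset ι, (G.g p Y : ℂ) * ∏ i ∈ Y, -((p : ℂ) ^ (-(z i)))

/-- **The comparison factor** `E'_{p,ξ} = ∏_i (1 - p^{-1-z_i})` (display (D.13) with `a_i = 1`:
the vertical sets are the singletons). [cite: GreenTao2010, App. D, (D.13)] -/
def eulerMain (p : ℕ) (z : ι → ℂ) : ℂ :=
  ∏ i, (1 - (p : ℂ) ^ (-(1 + z i)))

/-! ### `E_p` at the primes dividing `W`, and the expansion of `E'_p` -/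

/-- **`E_p = 1` when `p ∣ W`**: every nonempty pattern has `α(p, Y) = 0`.
[cite: GreenTao2010, App. D, proof of Prop. D.4 / (D.15) at `p ∣ W`] -/
theorem eulerFactor_eq_one_of_dvd {p : ℕ} (hp : p.Prime) (hpW : p ∣ W) (z : ι → ℂ) :
    eulerFactor G p z = 1 := by
  unfold eulerFactor
  rw [Fintype.sum_eq_single ∅]
  · simp [G.g_empty]
  · intro Y hY
    rw [G.g_dvd p hp hpW Y (nonempty_iff_ne_empty.2 hY)]
    simp

/-- `E'_p = ∑_Y ∏_{i ∈ Y} (-p^{-1-z_i})` (expanding the product). [folklore] -/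
theorem eulerMain_eq_sum (p : ℕ) (z : ι → ℂ) :
    eulerMain p z = ∑ Y : Finset ι, ∏ i ∈ Y, -((p : ℂ) ^ (-(1 + z i))) := by
  unfold eulerMain
  have h : ∏ i, (1 - (p : ℂ) ^ (-(1 + z i))) = ∏ i ∈ (univ : Finset ι), (1 + -((p : ℂ) ^ (-(1 + z i)))) :=
    prod_congr rfl fun i _ => by ring
  rw [h, Finset.prod_one_add, Finset.powerset_univ]

/-! ### `E_p` versus `E'_p` for `p ∤ W` (display (D.12)) -/

/-- **`E_p = E'_p + O(2^{|ι|}/p²)` for `p ∤ W`** (display (D.12): the patterns of size `≤ 1` agree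
exactly, `α(p,∅) = 1`, `α(p,{i}) = 1/p`; the others carry `α ≤ 1/p²` against `p^{-|Y|} ≤ 1/p²`).
[cite: GreenTao2010, App. D, (D.12)] -/
theorem norm_eulerFactor_sub_eulerMain_le {p : ℕ} (hp : p.Prime) (hpW : ¬ p ∣ W) {z : ι → ℂ}
    (hz : ∀ i, 0 ≤ (z i).re) :
    ‖eulerFactor G p z - eulerMain p z‖ ≤ 2 * 2 ^ Fintype.card ι / (p : ℝ) ^ 2 := by
  classical
  have hp1 : 1 ≤ p := hp.one_lt.le
  have hp0 : (0 : ℝ) < p := by exact_mod_cast hp.pos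
  rw [eulerMain_eq_sum]
  unfold eulerFactor
  rw [← Finset.sum_sub_distrib]
  -- termwise
  have hterm : ∀ Y : Finset ι, ‖(G.g p Y : ℂ) * ∏ i ∈ Y, -((p : ℂ) ^ (-(z i))) -
      ∏ i ∈ Y, -((p : ℂ) ^ (-(1 + z i)))‖ ≤ 2 / (p : ℝ) ^ 2 := by
    intro Y
    rw [prod_neg_cpow_neg_one_add hp1, ← sub_mul, norm_mul]
    have hcoef : ‖(G.g p Y : ℂ) - ((p : ℂ)⁻¹) ^ Y.card‖ ≤ 2 / (p : ℝ) ^ 2 := by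
      have e : (G.g p Y : ℂ) - ((p : ℂ)⁻¹) ^ Y.card = ((G.g p Y - ((p : ℝ)⁻¹) ^ Y.card : ℝ) : ℂ) := by
        push_cast; ring
      rw [e, Complex.norm_real, Real.norm_eq_abs]
      rcases Nat.lt_or_ge Y.card 2 with hc | hc
      · -- `|Y| ≤ 1`: exact agreement
        interval_cases h : Y.card
        · rw [Finset.card_eq_zero.mp h, G.g_empty, pow_zero, sub_self, abs_zero]; positivity
        · obtain ⟨i, rfl⟩ := Finset.card_eq_one.mp h
          rw [G.g_singleton p hp hpW i, pow_one, one_div, sub_self, abs_zero]; positivity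
      · have h1 : |G.g p Y| ≤ 1 / (p : ℝ) ^ 2 := by
          rw [abs_of_nonneg (G.g_nonneg p Y)]; exact G.g_two p hp hpW Y hc
        have h2 : |((p : ℝ)⁻¹) ^ Y.card| ≤ 1 / (p : ℝ) ^ 2 := by
          rw [abs_of_nonneg (by positivity), inv_pow, one_div]
          exact inv_anti₀ (by positivity) (pow_le_pow_right₀ (by exact_mod_cast hp1) hc)
        calc |G.g p Y - ((p : ℝ)⁻¹) ^ Y.card| ≤ |G.g p Y| + |((p : ℝ)⁻¹) ^ Y.card| := abs_sub _ _
          _ ≤ 1 / (p : ℝ) ^ 2 + 1 / (p : ℝ) ^ 2 := add_le_add h1 h2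
          _ = 2 / (p : ℝ) ^ 2 := by ring
    calc ‖(G.g p Y : ℂ) - ((p : ℂ)⁻¹) ^ Y.card‖ * ‖∏ i ∈ Y, -((p : ℂ) ^ (-(z i)))‖
        ≤ 2 / (p : ℝ) ^ 2 * 1 :=
          mul_le_mul hcoef (norm_prod_neg_cpow_le_one hp1 hz Y) (norm_nonneg _) (by positivity)
      _ = 2 / (p : ℝ) ^ 2 := mul_one _
  calc _ ≤ ∑ Y : Finset ι, ‖(G.g p Y : ℂ) * ∏ i ∈ Y, -((p : ℂ) ^ (-(z i))) -
        ∏ i ∈ Y, -((p : ℂ) ^ (-(1 + z i)))‖ := norm_sum_le _ _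
    _ ≤ ∑ _Y : Finset ι, 2 / (p : ℝ) ^ 2 := sum_le_sum fun Y _ => hterm Y
    _ = 2 * 2 ^ Fintype.card ι / (p : ℝ) ^ 2 := by
        rw [sum_const, card_univ, Fintype.card_finset, nsmul_eq_mul]
        push_cast
        ring

/-- **`|E'_p| ≥ 1/2`** for `p ≥ 2|ι|` (`∏_i |1 - p^{-1-z_i}| ≥ (1 - 1/p)^{|ι|} ≥ 1 - |ι|/p`).
[cite: GreenTao2010, App. D, proof of Lemma D.5 ("noting that the latter has magnitude comparable to `1`")] -/
theorem half_le_norm_eulerMain {p : ℕ} (hp : p.Prime) (hcard : 2 * Fintype.card ι ≤ p) {z : ι → ℂ}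
    (hz : ∀ i, 0 ≤ (z i).re) : 1 / 2 ≤ ‖eulerMain p z‖ := by
  have hp1 : 1 ≤ p := hp.one_lt.le
  have hp0 : (0 : ℝ) < p := by exact_mod_cast hp.pos
  have hpge : (2 : ℝ) ≤ p := by exact_mod_cast hp.two_le
  unfold eulerMain
  rw [norm_prod]
  have h1 : ∀ i, 1 - 1 / (p : ℝ) ≤ ‖1 - (p : ℂ) ^ (-(1 + z i))‖ := by
    intro i
    have h := norm_sub_norm_le (1 : ℂ) ((p : ℂ) ^ (-(1 + z i)))
    rw [norm_one] at h
    linarith [norm_natCast_cpow_neg_one_add_le hp1 (hz i)]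
  have h0 : 0 ≤ 1 - 1 / (p : ℝ) := by
    rw [sub_nonneg, div_le_one hp0]; linarith
  have hcard' : (Fintype.card ι : ℝ) * (1 / p) ≤ 1 / 2 := by
    rw [mul_one_div, div_le_div_iff₀ hp0 two_pos]
    have : (2 * Fintype.card ι : ℝ) ≤ p := by exact_mod_cast hcard
    linarith
  calc (1 : ℝ) / 2 ≤ 1 + Fintype.card ι * (-(1 / p)) := by linarith
    _ ≤ (1 + -(1 / (p : ℝ))) ^ Fintype.card ι :=
        one_add_mul_le_pow (by have : 1 / (p : ℝ) ≤ 1 := (div_le_one hp0).2 (by linarith); linarith) _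
    _ = ∏ _i : ι, (1 - 1 / (p : ℝ)) := by rw [prod_const, card_univ, sub_eq_add_neg]
    _ ≤ ∏ i, ‖1 - (p : ℂ) ^ (-(1 + z i))‖ := prod_le_prod (fun _ _ => h0) fun i _ => h1 i

/-- `E'_p ≠ 0` for `p ≥ 2` and `Re z_i ≥ 0` (each factor has `|p^{-1-z_i}| ≤ 1/2`). [folklore] -/
theorem eulerMain_ne_zero {p : ℕ} (hp : 2 ≤ p) {z : ι → ℂ} (hz : ∀ i, 0 ≤ (z i).re) :
    eulerMain p z ≠ 0 := by
  unfold eulerMain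
  refine prod_ne_zero_iff.2 fun i _ => ?_
  intro h
  have h1 : (p : ℂ) ^ (-(1 + z i)) = 1 := by linear_combination -h
  have h2 := norm_natCast_cpow_neg_one_add_le (show 1 ≤ p by omega) (hz i)
  rw [h1, norm_one] at h2
  have hp' : (2 : ℝ) ≤ p := by exact_mod_cast hp
  have : (1 : ℝ) / p ≤ 1 / 2 := by
    rw [div_le_div_iff₀ (by linarith) two_pos]; linarith
  linarith

/-- **`E_p = (1 + O(2^{|ι|}/p²)) E'_p` for `p ∤ W`, `p ≥ 2|ι|`** (display (D.12), in ratio form).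
[cite: GreenTao2010, App. D, (D.12)] -/
theorem norm_eulerFactor_div_sub_one_le {p : ℕ} (hp : p.Prime) (hpW : ¬ p ∣ W)
    (hcard : 2 * Fintype.card ι ≤ p) {z : ι → ℂ} (hz : ∀ i, 0 ≤ (z i).re) :
    ‖eulerFactor G p z / eulerMain p z - 1‖ ≤ 4 * 2 ^ Fintype.card ι / (p : ℝ) ^ 2 := by
  have hE' := eulerMain_ne_zero (ι := ι) hp.two_le hz
  have hhalf := half_le_norm_eulerMain hp hcard hz
  have e : eulerFactor G p z / eulerMain p z - 1 = (eulerFactor G p z - eulerMain p z) / eulerMain p z := by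
    field_simp
  rw [e, norm_div, div_le_iff₀ (lt_of_lt_of_le one_half_pos hhalf)]
  calc ‖eulerFactor G p z - eulerMain p z‖ ≤ 2 * 2 ^ Fintype.card ι / (p : ℝ) ^ 2 :=
        norm_eulerFactor_sub_eulerMain_le G hp hpW hz
    _ = 4 * 2 ^ Fintype.card ι / (p : ℝ) ^ 2 * (1 / 2) := by ring
    _ ≤ 4 * 2 ^ Fintype.card ι / (p : ℝ) ^ 2 * ‖eulerMain p z‖ :=
        mul_le_mul_of_nonneg_left hhalf (by positivity)

/-! ### The absolute local factor (the dominator for the limit `Q → ∞`) -/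

/-- **`|E_p| ≤ 1 + 3|ι| p^{-1-s} + 4^{|ι|}/p²`** when all `Re z_i = s ≥ 0` (`= 1` for `p ∣ W`; for
`p ∤ W` the singletons contribute `|ι| p^{-1-s}` and the larger patterns at most `2^{|ι|}/p²`) — the
shape consumed by `CFZ.prod_absLocalFactor_le`. [cite: GreenTao2010, App. D, proof of Thm. D.3 ("Crude computations then show …")] -/
theorem norm_eulerFactor_le {p : ℕ} (hp : p.Prime) {z : ι → ℂ} {s : ℝ} (hs : 0 ≤ s)
    (hre : ∀ i, (z i).re = s) :
    ‖eulerFactor G p z‖ ≤ 1 + 3 * Fintype.card ι * (p : ℝ) ^ (-(1 + s)) + 4 ^ Fintype.card ι / (p : ℝ) ^ 2 := by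
  classical
  have hp1 : 1 ≤ p := hp.one_lt.le
  have hp0 : (0 : ℝ) < p := by exact_mod_cast hp.pos
  have hpr : (1 : ℝ) ≤ p := by exact_mod_cast hp1
  by_cases hpW : p ∣ W
  · rw [eulerFactor_eq_one_of_dvd G hp hpW, norm_one]
    have : 0 ≤ 3 * Fintype.card ι * (p : ℝ) ^ (-(1 + s)) + 4 ^ Fintype.card ι / (p : ℝ) ^ 2 := by
      positivity
    linarith
  -- termwise bound `t(Y)`
  set tY : Finset ι → ℝ := fun Y =>
    (if Y = ∅ then 1 else 0) + (if Y.card = 1 then (p : ℝ) ^ (-(1 + s)) else 0) +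
      (if 2 ≤ Y.card then 1 / (p : ℝ) ^ 2 else 0) with htY
  have hps : ∀ i, ‖-((p : ℂ) ^ (-(z i)))‖ = (p : ℝ) ^ (-s) := by
    intro i
    rw [norm_neg, Complex.norm_natCast_cpow_of_pos hp.pos, Complex.neg_re, hre i]
  have hps1 : (p : ℝ) ^ (-s) ≤ 1 := Real.rpow_le_one_of_one_le_of_nonpos hpr (by linarith)
  have hterm : ∀ Y : Finset ι, ‖(G.g p Y : ℂ) * ∏ i ∈ Y, -((p : ℂ) ^ (-(z i)))‖ ≤ tY Y := by
    intro Y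
    rw [norm_mul, Complex.norm_real, Real.norm_eq_abs, abs_of_nonneg (G.g_nonneg p Y), norm_prod,
      prod_congr rfl fun i _ => hps i, prod_const]
    simp only [htY]
    rcases Nat.lt_or_ge Y.card 2 with hc | hc
    · interval_cases h : Y.card
      · rw [Finset.card_eq_zero.mp h, G.g_empty]
        simp
      · obtain ⟨i, rfl⟩ := Finset.card_eq_one.mp h
        rw [G.g_singleton p hp hpW i, pow_one]
        have e : (p : ℝ) ^ (-(1 + s)) = 1 / p * (p : ℝ) ^ (-s) := by
          rw [neg_add, Real.rpow_add hp0, Real.rpow_neg_one, one_div]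
        rw [if_neg (Finset.singleton_ne_empty i), if_pos rfl, if_neg (by norm_num), zero_add, add_zero, e]
    · have hne : Y ≠ ∅ := by rintro rfl; simp at hc
      have hc1 : Y.card ≠ 1 := by omega
      simp only [hne, if_false, hc1, zero_add, hc, if_true]
      calc G.g p Y * ((p : ℝ) ^ (-s)) ^ Y.card ≤ 1 / (p : ℝ) ^ 2 * 1 :=
            mul_le_mul (G.g_two p hp hpW Y hc) (pow_le_one₀ (by positivity) hps1) (by positivity)
              (by positivity)
        _ = 1 / (p : ℝ) ^ 2 := mul_one _
  -- summing `t(Y)`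
  have hsum1 : ∑ Y : Finset ι, (if Y = ∅ then (1 : ℝ) else 0) = 1 := by
    rw [Finset.sum_ite_eq']; simp
  have hsum2 : ∑ Y : Finset ι, (if Y.card = 1 then (p : ℝ) ^ (-(1 + s)) else 0) =
      Fintype.card ι * (p : ℝ) ^ (-(1 + s)) := by
    rw [← Finset.sum_filter]
    have hset : (univ : Finset (Finset ι)).filter (fun Y => Y.card = 1) = (univ : Finset ι).powersetCard 1 := by
      ext Y; simp [Finset.mem_powersetCard]
    rw [hset, sum_const, Finset.card_powersetCard, card_univ, Nat.choose_one_right, nsmul_eq_mul]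
  have hsum3 : ∑ Y : Finset ι, (if 2 ≤ Y.card then 1 / (p : ℝ) ^ 2 else 0) ≤ 4 ^ Fintype.card ι / (p : ℝ) ^ 2 := by
    calc ∑ Y : Finset ι, (if 2 ≤ Y.card then 1 / (p : ℝ) ^ 2 else 0) ≤ ∑ _Y : Finset ι, 1 / (p : ℝ) ^ 2 :=
          sum_le_sum fun Y _ => by split_ifs <;> first | exact le_rfl | positivity
      _ = 2 ^ Fintype.card ι / (p : ℝ) ^ 2 := by
          rw [sum_const, card_univ, Fintype.card_finset, nsmul_eq_mul]; push_cast; ring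
      _ ≤ 4 ^ Fintype.card ι / (p : ℝ) ^ 2 := by
          gcongr; norm_num
  unfold eulerFactor
  calc _ ≤ ∑ Y : Finset ι, ‖(G.g p Y : ℂ) * ∏ i ∈ Y, -((p : ℂ) ^ (-(z i)))‖ := norm_sum_le _ _
    _ ≤ ∑ Y : Finset ι, tY Y := sum_le_sum fun Y _ => hterm Y
    _ = 1 + Fintype.card ι * (p : ℝ) ^ (-(1 + s)) +
          ∑ Y : Finset ι, (if 2 ≤ Y.card then 1 / (p : ℝ) ^ 2 else 0) := by
        simp only [htY, sum_add_distrib, hsum1, hsum2]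
    _ ≤ 1 + 3 * Fintype.card ι * (p : ℝ) ^ (-(1 + s)) + 4 ^ Fintype.card ι / (p : ℝ) ^ 2 := by
        have : (Fintype.card ι : ℝ) * (p : ℝ) ^ (-(1 + s)) ≤ 3 * Fintype.card ι * (p : ℝ) ^ (-(1 + s)) := by
          have h0 : 0 ≤ (Fintype.card ι : ℝ) * (p : ℝ) ^ (-(1 + s)) := by positivity
          linarith
        linarith [hsum3]

/-! ### The finite Euler product over square-free tuples -/

section tuples

variable [DecidableEq ι]

/-- The multiplicative sum over tuples of square-free numbers with prime factors in `P`: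
`∑_{(m_i)} (∏_{p ∈ P} α(p, {i : p ∣ m_i})) ∏_i μ(m_i) m_i^{-z_i}` (the sum (D.10) after the Chinese
remainder factorisation of the weights). [cite: GreenTao2010, App. D, (D.9)–(D.10)] -/
def tupleSum (P : Finset ℕ) (z : ι → ℂ) : ℂ :=
  ∑ d ∈ Fintype.piFinset (fun _ : ι => squarefreeOf P),
    (∏ p ∈ P, (G.g p (pattern d p) : ℂ)) * ∏ i, ((ArithmeticFunction.moebius (d i) : ℂ) * (d i : ℂ) ^ (-(z i)))

/-- **`∑_{tuples} = ∏_{p ∈ P} E_p`** ("Using the multiplicativity of `α` once more, we can write this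
expression as `∏_p E_{p,ξ}`", display (D.10)), for a finite set of primes `P`.
[cite: GreenTao2010, App. D, (D.10)] -/
theorem tupleSum_eq_prod_eulerFactor {P : Finset ℕ} (hP : ∀ p ∈ P, p.Prime) (z : ι → ℂ) :
    tupleSum G P z = ∏ p ∈ P, eulerFactor G p z := by
  classical
  set f : P → Finset ι → ℂ := fun p Y => (G.g p Y : ℂ) * ∏ i ∈ Y, -(((p : ℕ) : ℂ) ^ (-(z i))) with hf
  have hrhs : ∏ p ∈ P, eulerFactor G p z = ∏ p : P, ∑ Y : Finset ι, f p Y := by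
    rw [← prod_coe_sort P]
    rfl
  rw [hrhs, ← sum_squarefreeTuples_eq_prod hP f]
  refine sum_congr rfl fun d hd => ?_
  rw [Fintype.mem_piFinset] at hd
  have hsq : ∀ i, Squarefree (d i) ∧ (d i).primeFactors ⊆ P := fun i => (mem_squarefreeOf hP).1 (hd i)
  have hcoef : ∏ i, ((ArithmeticFunction.moebius (d i) : ℂ) * (d i : ℂ) ^ (-(z i))) =
      ∏ p ∈ P, ∏ i ∈ pattern d p, -((p : ℂ) ^ (-(z i))) := by
    rw [Fintype.prod_congr _ _ fun i => moebius_mul_cpow_eq_prod (hsq i).1 (z i)]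
    rw [Finset.prod_comm' (s := univ) (t := fun i => (d i).primeFactors) (t' := P)
      (s' := fun p => pattern d p)]
    intro i p
    simp only [mem_univ, true_and, pattern, mem_filter]
    constructor
    · intro hp
      exact ⟨Nat.dvd_of_mem_primeFactors hp, (hsq i).2 hp⟩
    · rintro ⟨hpd, hpP⟩
      exact Nat.mem_primeFactors.2 ⟨hP p hpP, hpd, (hsq i).1.ne_zero⟩
  rw [hcoef, ← prod_mul_distrib, ← prod_coe_sort P]

end tuples

/-! ### The Euler product of `E'_p`: `∏_p E'_p = ∏_i ζ(1 + z_i)^{-1}` -/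

section limit

open Filter Topology

/-- **`∏_{p<n} E'_p → ∏_i ζ(1+z_i)^{-1}`** for `Re z_i > 0` (footnote to (D.13):
"`∏_p E'_{p,ξ} = ∏_{B vertical} ζ(1 + ∑_{(i,j) ∈ B} z_{i,j})^{(-1)^{|B|}}`", here all vertical sets are
singletons). [cite: GreenTao2010, App. D, (D.13) and footnote] -/
theorem tendsto_prod_eulerMain {z : ι → ℂ} (hz : ∀ i, 0 < (z i).re) :
    Tendsto (fun n : ℕ => ∏ p ∈ n.primesBelow, eulerMain p z) atTop
      (𝓝 (∏ i, (riemannZeta (1 + z i))⁻¹)) := by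
  have h1 : ∀ i, 1 < (1 + z i).re := fun i => by simp; exact hz i
  have hswap : ∀ n : ℕ, ∏ p ∈ n.primesBelow, eulerMain p z =
      ∏ i, ∏ p ∈ n.primesBelow, (1 - (p : ℂ) ^ (-(1 + z i))) := fun n => Finset.prod_comm
  simp_rw [hswap]
  exact tendsto_finsetProd _ fun i _ => tendsto_prod_one_sub_cpow (h1 i)

/-- The exponent vector `z(η) = ((1 - 2πiη_i)/log R)_i`. [cite: GreenTao2010, App. D ("`z_{i,j} := (1 + iξ_{i,j})/log R`")] -/
def zVec (R : ℝ) (η : ι → ℝ) : ι → ℂ := fun i => zOf R (η i)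

omit [Fintype ι] in
/-- `Re z_i(η) = 1/log R > 0` for `R > 1`. [folklore] -/
theorem zVec_re (R : ℝ) (η : ι → ℝ) (i : ι) : (zVec R η i).re = 1 / Real.log R := zOf_re R (η i)

omit [Fintype ι] in
/-- `Re z_i(η) > 0` for `R > 1`. [folklore] -/
theorem zVec_re_pos {R : ℝ} (hR : 1 < R) (η : ι → ℝ) (i : ι) : 0 < (zVec R η i).re := by
  rw [zVec_re]; exact div_pos one_pos (Real.log_pos hR)

variable (R : ℝ) (w : ℕ) (η : ι → ℝ)

/-- The correction sequence `δ'_q = E_q/E'_q - 1` at the primes `q > w`, `0` elsewhere.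
[cite: GreenTao2010, App. D, proof of Prop. D.4] -/
def deltaSeq (q : ℕ) : ℂ :=
  if q.Prime ∧ w < q then eulerFactor G q (zVec R η) / eulerMain q (zVec R η) - 1 else 0

/-- `δ'_q = 0` for `q ≤ w`. [folklore] -/
theorem deltaSeq_eq_zero_of_le {q : ℕ} (hq : q ≤ w) : deltaSeq G R w η q = 0 := by
  unfold deltaSeq; rw [if_neg]; rintro ⟨-, h⟩; omega

/-- **The finite decomposition** for `Q > w`, when `E_p = 1` for the primes `p ≤ w` (`p ∣ W ↔ p ≤ w`):
`∏_{p<Q} E_p = (∏_{p<Q} E'_p / ∏_{p≤w} E'_p) · ∏_{q<Q} (1 + δ'_q)`.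
[cite: GreenTao2010, App. D, proof of Prop. D.4] -/
theorem prod_eulerFactor_eq_of_lt (hR : 1 < R) (hW : ∀ p : ℕ, p.Prime → (p ∣ W ↔ p ≤ w)) {Q : ℕ}
    (hQ : w < Q) :
    ∏ p ∈ Q.primesBelow, eulerFactor G p (zVec R η) =
      (∏ p ∈ Q.primesBelow, eulerMain p (zVec R η)) /
          (∏ p ∈ (w + 1).primesBelow, eulerMain p (zVec R η)) *
        ∏ q ∈ range Q, (1 + deltaSeq G R w η q) := by
  classical
  have hzre : ∀ i, 0 ≤ (zVec R η i).re := fun i => (zVec_re_pos hR η i).le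
  set E : ℕ → ℂ := fun p => eulerFactor G p (zVec R η) with hE
  set E' : ℕ → ℂ := fun p => eulerMain p (zVec R η) with hE'
  have hsplit : ∀ f : ℕ → ℂ, ∏ p ∈ Q.primesBelow, f p =
      (∏ p ∈ (Q.primesBelow).filter (fun p => p ≤ w), f p) *
        ∏ p ∈ (Q.primesBelow).filter (fun p => ¬ p ≤ w), f p :=
    fun f => (prod_filter_mul_prod_filter_not _ _ _).symm
  have hS₁ : (Q.primesBelow).filter (fun p => p ≤ w) = (w + 1).primesBelow := by
    ext p; simp only [mem_filter, Nat.mem_primesBelow]; constructor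
    · rintro ⟨⟨_, hp⟩, hpw⟩; exact ⟨by omega, hp⟩
    · rintro ⟨hpw, hp⟩; exact ⟨⟨by omega, hp⟩, by omega⟩
  have hsmall : ∏ p ∈ (Q.primesBelow).filter (fun p => p ≤ w), E p = 1 := by
    refine prod_eq_one fun p hp => ?_
    rw [mem_filter, Nat.mem_primesBelow] at hp
    exact eulerFactor_eq_one_of_dvd G hp.1.2 ((hW p hp.1.2).2 hp.2) _
  have hE'0 : ∀ p ∈ Q.primesBelow, E' p ≠ 0 := fun p hp =>
    eulerMain_ne_zero (Nat.mem_primesBelow.1 hp).2.two_le hzre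
  have hlarge : ∏ p ∈ (Q.primesBelow).filter (fun p => ¬ p ≤ w), E p =
      (∏ p ∈ (Q.primesBelow).filter (fun p => ¬ p ≤ w), E' p) *
        ∏ p ∈ (Q.primesBelow).filter (fun p => ¬ p ≤ w), E p / E' p := by
    rw [← prod_mul_distrib]
    exact prod_congr rfl fun p hp => by rw [mul_div_cancel₀ _ (hE'0 p (mem_filter.1 hp).1)]
  have hδ : ∏ q ∈ range Q, (1 + deltaSeq G R w η q) =
      ∏ p ∈ (Q.primesBelow).filter (fun p => ¬ p ≤ w), E p / E' p := by
    have h1 : ∀ q, 1 + deltaSeq G R w η q = if q.Prime ∧ w < q then E q / E' q else 1 := by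
      intro q; unfold deltaSeq; split_ifs <;> ring
    simp_rw [h1]
    rw [← prod_filter]
    refine prod_congr ?_ fun _ _ => rfl
    ext q
    simp only [mem_filter, mem_range, Nat.mem_primesBelow, not_le]
    tauto
  have hden : ∏ p ∈ (w + 1).primesBelow, E' p ≠ 0 := prod_ne_zero_iff.2 fun p hp =>
    eulerMain_ne_zero (Nat.mem_primesBelow.1 hp).2.two_le hzre
  rw [hsplit E, hsmall, one_mul, hlarge, hδ, hsplit E', hS₁, mul_div_cancel_left₀ _ hden]

/-- **`‖δ'_q‖ ≤ 4·2^{|ι|}/q²`** for all `q`, once `w ≥ 2|ι|` and `p ∣ W ↔ p ≤ w`.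
[cite: GreenTao2010, App. D, (D.12)] -/
theorem norm_deltaSeq_le (hR : 1 < R) (hW : ∀ p : ℕ, p.Prime → (p ∣ W ↔ p ≤ w))
    (hw : 2 * Fintype.card ι ≤ w) (q : ℕ) :
    ‖deltaSeq G R w η q‖ ≤ 4 * 2 ^ Fintype.card ι / (q : ℝ) ^ 2 := by
  have hzre : ∀ i, 0 ≤ (zVec R η i).re := fun i => (zVec_re_pos hR η i).le
  unfold deltaSeq
  split_ifs with h
  · obtain ⟨hq, hwq⟩ := h
    have hqW : ¬ q ∣ W := fun hd => by have := (hW q hq).1 hd; omega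
    exact norm_eulerFactor_div_sub_one_le G hq hqW (by omega) hzre
  · rw [norm_zero]; positivity

/-- **The correction product is `1 + O(1/w)`**: `δ'` is absolutely summable, `∑' ‖δ'_q‖ ≤ 4·2^{|ι|}/w`
and `‖∏'_q (1 + δ'_q) - 1‖ ≤ exp(4·2^{|ι|}/w) - 1` ("`∏_{p > w} β_p = ∏_{p>w} (1 + O(1/p²)) = 1 + o(1)`",
here for the primes `> w`, all non-exceptional). [cite: GreenTao2010, App. D, proof of Prop. D.4 and p. 1834] -/
theorem deltaSeq_summable_and_bounds (hR : 1 < R) (hW : ∀ p : ℕ, p.Prime → (p ∣ W ↔ p ≤ w))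
    (hw : 2 * Fintype.card ι ≤ w) (hw1 : 1 ≤ w) :
    (Summable fun q => ‖deltaSeq G R w η q‖) ∧
      ∑' q, ‖deltaSeq G R w η q‖ ≤ 4 * 2 ^ Fintype.card ι / w ∧
        ‖∏' q, (1 + deltaSeq G R w η q) - 1‖ ≤ Real.exp (4 * 2 ^ Fintype.card ι / (w : ℝ)) - 1 :=
  norm_tprod_sub_one_le_of_sq_decay _ (by positivity) hw1 (fun q hq => deltaSeq_eq_zero_of_le G R w η hq)
    fun q _ => norm_deltaSeq_le G R w η hR hW hw q

/-- **The limit `Q → ∞` of `∏_{p<Q} E_p`**: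
`∏_{p<Q} E_p → (∏_i ζ(1+z_i)^{-1}) / (∏_{p≤w} E'_p) · ∏'_q (1 + δ'_q)`.
[cite: GreenTao2010, App. D, (D.10)–(D.13) and Prop. D.4] -/
theorem tendsto_prod_eulerFactor (hR : 1 < R) (hW : ∀ p : ℕ, p.Prime → (p ∣ W ↔ p ≤ w))
    (hw : 2 * Fintype.card ι ≤ w) (hw1 : 1 ≤ w) :
    Tendsto (fun Q : ℕ => ∏ p ∈ Q.primesBelow, eulerFactor G p (zVec R η)) atTop
      (𝓝 ((∏ i, (riemannZeta (1 + zVec R η i))⁻¹) /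
          (∏ p ∈ (w + 1).primesBelow, eulerMain p (zVec R η)) *
        ∏' q, (1 + deltaSeq G R w η q))) := by
  have hsum := (deltaSeq_summable_and_bounds G R w η hR hW hw hw1).1
  have h1 := ((tendsto_prod_eulerMain (zVec_re_pos hR η)).div_const
    (∏ p ∈ (w + 1).primesBelow, eulerMain p (zVec R η))).mul
    (multipliable_one_add_of_summable hsum).hasProd.tendsto_prod_nat
  refine h1.congr' ?_
  filter_upwards [eventually_gt_atTop w] with Q hQ
  exact (prod_eulerFactor_eq_of_lt G R w η hR hW hQ).symm

/-- **The partial Euler products are uniformly bounded** in `Q` and `η` (for the dominated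
convergence): `‖∏_{p<Q} E_p(z(η))‖ ≤ (log R + C)^{3|ι|} exp(2·4^{|ι|})` for `R ≥ e`.
[cite: GreenTao2010, App. D, proof of Thm. D.3 ("the summation can be shown to be absolutely convergent")] -/
theorem exists_norm_prod_eulerFactor_le :
    ∃ C : ℝ, 0 ≤ C ∧ ∀ R : ℝ, Real.exp 1 ≤ R → ∀ (Q : ℕ) (η : ι → ℝ),
      ‖∏ p ∈ Q.primesBelow, eulerFactor G p (zVec R η)‖ ≤
        (Real.log R + C) ^ (3 * Fintype.card ι) * Real.exp (2 * 4 ^ Fintype.card ι) := by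
  obtain ⟨C, hC0, hC⟩ := prod_absLocalFactor_le
  refine ⟨C, hC0, fun R hR Q η => ?_⟩
  have hR1 : 1 < R := lt_of_lt_of_le (by have := Real.exp_one_gt_d9; linarith) hR
  have hlogR : 1 ≤ Real.log R := by rwa [Real.le_log_iff_exp_le (by linarith)]
  set s : ℝ := 1 / Real.log R with hs
  have hs0 : 0 < s := by positivity
  have hs1 : s ≤ 1 := by rw [hs, div_le_one (by linarith)]; exact hlogR
  have hre : ∀ i, (zVec R η i).re = s := fun i => zVec_re R η i
  rw [norm_prod]
  have h := hC (Fintype.card ι) Q (fun p => ‖eulerFactor G p (zVec R η)‖) s hs0 hs1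
    (fun p _ => norm_nonneg _)
    (fun p hp => norm_eulerFactor_le G (Nat.mem_primesBelow.1 hp).2 hs0.le hre)
  rw [hs, one_div_one_div] at h
  exact h

end limit

/-! ### The tuple sum as an integral over `ℝ^ι` (Fourier expansion of `χ`, display (D.10)) -/

section integral

open MeasureTheory Filter Topology

/-- Lebesgue measure on `ℝ^ι` (a product; definitionally the `volume`). [folklore] -/
def fullMeasure (ι : Type*) [Fintype ι] : Measure (ι → ℝ) := Measure.pi fun _ => (volume : Measure ℝ)

omit [Fintype ι] in
/-- `fullMeasure ι = volume`. [folklore] -/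
@[simp] theorem fullMeasure_eq_volume [Fintype ι] : fullMeasure ι = (volume : Measure (ι → ℝ)) := rfl

variable {χ : ℝ → ℝ} (hs : ContDiff ℝ (⊤ : ℕ∞) χ) (hsupp : ∀ x, 1 ≤ |x| → χ x = 0)
include hs hsupp

/-- The summands `c ∏_i μ(d_i) φ(η_i) d_i^{-z_i(η)}` are integrable on `ℝ^ι` (dominated by
`|c| ∏_i |φ(η_i)|`), `R > 1`. [cite: GreenTao2010, App. D, proof of Thm. D.3 (justification of the interchange)] -/
theorem integrable_coef_prod_full {R : ℝ} (hR : 1 < R) (d : ι → ℕ) (hd : ∀ i, 1 ≤ d i) (c : ℂ) :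
    Integrable (fun η : ι → ℝ =>
      c * ∏ i, ((ArithmeticFunction.moebius (d i) : ℂ) * (phiF χ (η i) * ((d i : ℕ) : ℂ) ^ (-(zOf R (η i))))))
      (fullMeasure ι) := by
  have hφi := phiF_integrable hs hsupp
  have hφc : Continuous (phiF χ) := by rw [← phiS_coe hs hsupp]; exact (phiS hs hsupp).continuous
  have hdom : Integrable (fun η : ι → ℝ => ‖c‖ * ∏ i, ‖phiF χ (η i)‖) (fullMeasure ι) := by
    unfold fullMeasure
    exact (Integrable.fintype_prod (f := fun _ x => ‖phiF χ x‖) fun _ => hφi.norm).const_mul _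
  have hcont : Continuous fun η : ι → ℝ =>
      c * ∏ i, ((ArithmeticFunction.moebius (d i) : ℂ) * (phiF χ (η i) * ((d i : ℕ) : ℂ) ^ (-(zOf R (η i))))) := by
    refine continuous_const.mul (continuous_finsetProd _ fun i _ => continuous_const.mul ?_)
    refine (hφc.comp (continuous_apply i)).mul ?_
    have hd0 : ((d i : ℕ) : ℂ) ≠ 0 := by exact_mod_cast (by have := hd i; omega : d i ≠ 0)
    exact Continuous.const_cpow (((continuous_zOf R).comp (continuous_apply i)).neg) (Or.inl hd0)
  refine hdom.mono' hcont.aestronglyMeasurable (Filter.Eventually.of_forall fun η => ?_)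
  rw [norm_mul, norm_prod]
  refine mul_le_mul_of_nonneg_left (prod_le_prod (fun i _ => norm_nonneg _) fun i _ => ?_) (norm_nonneg _)
  rw [norm_mul, norm_mul, norm_natCast_cpow_neg_zOf R (hd i)]
  have hμ : ‖(ArithmeticFunction.moebius (d i) : ℂ)‖ ≤ 1 := by
    rw [Complex.norm_intCast]; exact_mod_cast ArithmeticFunction.abs_moebius_le_one
  have hds : (d i : ℝ) ^ (-(1 / Real.log R)) ≤ 1 :=
    Real.rpow_le_one_of_one_le_of_nonpos (by exact_mod_cast hd i) (by
      rw [neg_nonpos]; exact div_nonneg zero_le_one (Real.log_pos hR).le)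
  calc ‖(ArithmeticFunction.moebius (d i) : ℂ)‖ * (‖phiF χ (η i)‖ * (d i : ℝ) ^ (-(1 / Real.log R)))
      ≤ 1 * (‖phiF χ (η i)‖ * 1) := by gcongr
    _ = ‖phiF χ (η i)‖ := by ring

variable [DecidableEq ι]

/-- **The tuple sum as an integral over `ℝ^ι`, exactly** ("we write this term as
`log^t R ∫_I…∫_I ∑ ∏ μ(m) m^{-z} α … φ dξ` … Using the multiplicativity of `α` once more … `∏_p E_{p,ξ}`",
here with the integrals over all of `ℝ` since `χ(log m/log R) = ∫ φ(η) m^{-z(η)} dη` holds exactly):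
for square-free tuples with prime factors in a finite set of primes `P`,
`∑_{d} (∏_{p∈P} α(p, X_p(d))) (∏_i μ(d_i)) ∏_i χ(log d_i/log R) = ∫ (∏_i φ(η_i)) ∏_{p∈P} E_p(z(η)) dη`.
[cite: GreenTao2010, App. D, (D.10)] -/
theorem sum_coef_prod_chi_eq_integral {R : ℝ} (hR : 1 < R) {P : Finset ℕ} (hP : ∀ p ∈ P, p.Prime) :
    ∑ d ∈ Fintype.piFinset (fun _ : ι => squarefreeOf P),
        (∏ p ∈ P, (G.g p (pattern d p) : ℂ)) *
          ((∏ i, (ArithmeticFunction.moebius (d i) : ℂ)) * ∏ i, ((χ (Real.log (d i) / Real.log R) : ℝ) : ℂ)) =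
      ∫ η, (∏ i, phiF χ (η i)) * ∏ p ∈ P, eulerFactor G p (zVec R η) ∂(fullMeasure ι) := by
  have hd1 : ∀ d ∈ Fintype.piFinset (fun _ : ι => squarefreeOf P), ∀ i, 1 ≤ d i := by
    intro d hd i
    have h := (mem_squarefreeOf hP).1 (Fintype.mem_piFinset.1 hd i)
    exact Nat.pos_of_ne_zero h.1.ne_zero
  have hterm : ∀ d ∈ Fintype.piFinset (fun _ : ι => squarefreeOf P),
      (∏ p ∈ P, (G.g p (pattern d p) : ℂ)) *
          ((∏ i, (ArithmeticFunction.moebius (d i) : ℂ)) * ∏ i, ((χ (Real.log (d i) / Real.log R) : ℝ) : ℂ)) =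
        ∫ η, (∏ p ∈ P, (G.g p (pattern d p) : ℂ)) *
          ∏ i, ((ArithmeticFunction.moebius (d i) : ℂ) * (phiF χ (η i) * ((d i : ℕ) : ℂ) ^ (-(zOf R (η i)))))
          ∂(fullMeasure ι) := by
    intro d hd
    have hχ : ∏ i, ((χ (Real.log (d i) / Real.log R) : ℝ) : ℂ) =
        ∫ η, ∏ i, phiF χ (η i) * ((d i : ℕ) : ℂ) ^ (-(zOf R (η i))) ∂(fullMeasure ι) := by
      unfold fullMeasure
      rw [integral_fintype_prod_eq_prod (f := fun i x => phiF χ x * ((d i : ℕ) : ℂ) ^ (-(zOf R x)))]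
      exact Fintype.prod_congr _ _ fun i => chi_eq_integral hs hsupp hR (hd1 d hd i)
    rw [hχ, ← integral_const_mul, ← integral_const_mul]
    refine integral_congr_ae (Filter.Eventually.of_forall fun η => ?_)
    simp only [prod_mul_distrib]
  rw [sum_congr rfl hterm, ← integral_finsetSum _ fun d hd =>
    integrable_coef_prod_full hs hsupp hR d (hd1 d hd) _]
  refine integral_congr_ae (Filter.Eventually.of_forall fun η => ?_)
  show ∑ d ∈ Fintype.piFinset (fun _ : ι => squarefreeOf P),
      (∏ p ∈ P, (G.g p (pattern d p) : ℂ)) *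
        ∏ i, ((ArithmeticFunction.moebius (d i) : ℂ) * (phiF χ (η i) * ((d i : ℕ) : ℂ) ^ (-(zOf R (η i))))) =
    (∏ i, phiF χ (η i)) * ∏ p ∈ P, eulerFactor G p (zVec R η)
  rw [← tupleSum_eq_prod_eulerFactor G hP]
  unfold tupleSum
  rw [mul_sum]
  refine sum_congr rfl fun d _ => ?_
  simp only [zVec, prod_mul_distrib]
  ring

omit [DecidableEq ι] in
/-- **`I_Q → I_∞` on `ℝ^ι`**: dominated convergence, dominator `B ‖∏_i φ(η_i)‖`.
[cite: GreenTao2010, App. D, proof of Thm. D.3] -/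
theorem tendsto_integral_prod_eulerFactor_full (R : ℝ) {B : ℝ}
    (hB : ∀ (Q : ℕ) (η : ι → ℝ), ‖∏ p ∈ Q.primesBelow, eulerFactor G p (zVec R η)‖ ≤ B)
    {l : (ι → ℝ) → ℂ}
    (hlim : ∀ η : ι → ℝ,
      Tendsto (fun Q : ℕ => ∏ p ∈ Q.primesBelow, eulerFactor G p (zVec R η)) atTop (𝓝 (l η))) :
    Tendsto (fun Q : ℕ => ∫ η, (∏ i, phiF χ (η i)) * ∏ p ∈ Q.primesBelow, eulerFactor G p (zVec R η)
        ∂(fullMeasure ι)) atTop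
      (𝓝 (∫ η, (∏ i, phiF χ (η i)) * l η ∂(fullMeasure ι))) := by
  have hφi := phiF_integrable hs hsupp
  have hφc : Continuous (phiF χ) := by rw [← phiS_coe hs hsupp]; exact (phiS hs hsupp).continuous
  have hΦc : Continuous fun η : ι → ℝ => ∏ i, phiF χ (η i) :=
    continuous_finsetProd _ fun i _ => hφc.comp (continuous_apply i)
  have hΦi : Integrable (fun η : ι → ℝ => ‖∏ i, phiF χ (η i)‖ * B) (fullMeasure ι) := by
    have h1 : Integrable (fun η : ι → ℝ => ∏ i, phiF χ (η i)) (fullMeasure ι) := by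
      unfold fullMeasure; exact Integrable.fintype_prod (f := fun _ x => phiF χ x) fun _ => hφi
    exact h1.norm.mul_const B
  have hEc : ∀ p : ℕ, 0 < p → Continuous fun η : ι → ℝ => eulerFactor G p (zVec R η) := by
    intro p hp
    unfold eulerFactor
    refine continuous_finsetSum _ fun Y _ => continuous_const.mul (continuous_finsetProd _ fun i _ => ?_)
    refine Continuous.neg (Continuous.const_cpow ?_ (Or.inl (by exact_mod_cast hp.ne')))
    exact ((continuous_zOf R).comp (continuous_apply i)).neg
  refine tendsto_integral_of_dominated_convergence (fun η => ‖∏ i, phiF χ (η i)‖ * B)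
    (fun Q => ?_) hΦi (fun Q => Filter.Eventually.of_forall fun η => ?_)
    (Filter.Eventually.of_forall fun η => ?_)
  · refine (hΦc.mul ?_).aestronglyMeasurable
    exact continuous_finsetProd _ fun p hp => hEc p (Nat.mem_primesBelow.1 hp).2.pos
  · rw [norm_mul]
    exact mul_le_mul_of_nonneg_left (hB Q η) (norm_nonneg _)
  · exact tendsto_const_nhds.mul (hlim η)

/-- **The tuple sum in the limit**: for `R ≥ e`, `w ≥ 2|ι|`, `w ≥ 1`, `p ∣ W ↔ p ≤ w`, and any
`Q₀ > R`, the (eventually constant) sums over square-free tuples with prime factors `< Q₀` equal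
`∫ (∏_i φ(η_i)) L(η) dη` with `L(η) = (∏_i ζ(1+z_i)^{-1}/∏_{p≤w} E'_p) ∏'_q (1 + δ'_q)`, provided the
sums for `Q ≥ Q₀` do not depend on `Q` (in the application: `χ(log m/log R) = 0` for `m ≥ R`).
[cite: GreenTao2010, App. D, (D.10)–(D.13), Prop. D.4] -/
theorem sum_coef_prod_chi_eq_integral_limit {R : ℝ} (hR : Real.exp 1 ≤ R) {w : ℕ}
    (hW : ∀ p : ℕ, p.Prime → (p ∣ W ↔ p ≤ w)) (hw : 2 * Fintype.card ι ≤ w) (hw1 : 1 ≤ w) {Q₀ : ℕ}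
    (hconst : ∀ Q, Q₀ ≤ Q →
      ∑ d ∈ Fintype.piFinset (fun _ : ι => squarefreeOf Q.primesBelow),
        (∏ p ∈ Q.primesBelow, (G.g p (pattern d p) : ℂ)) *
          ((∏ i, (ArithmeticFunction.moebius (d i) : ℂ)) * ∏ i, ((χ (Real.log (d i) / Real.log R) : ℝ) : ℂ)) =
      ∑ d ∈ Fintype.piFinset (fun _ : ι => squarefreeOf Q₀.primesBelow),
        (∏ p ∈ Q₀.primesBelow, (G.g p (pattern d p) : ℂ)) *
          ((∏ i, (ArithmeticFunction.moebius (d i) : ℂ)) * ∏ i, ((χ (Real.log (d i) / Real.log R) : ℝ) : ℂ))) :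
    ∑ d ∈ Fintype.piFinset (fun _ : ι => squarefreeOf Q₀.primesBelow),
        (∏ p ∈ Q₀.primesBelow, (G.g p (pattern d p) : ℂ)) *
          ((∏ i, (ArithmeticFunction.moebius (d i) : ℂ)) * ∏ i, ((χ (Real.log (d i) / Real.log R) : ℝ) : ℂ)) =
      ∫ η, (∏ i, phiF χ (η i)) *
        ((∏ i, (riemannZeta (1 + zVec R η i))⁻¹) /
            (∏ p ∈ (w + 1).primesBelow, eulerMain p (zVec R η)) *
          ∏' q, (1 + deltaSeq G R w η q)) ∂(fullMeasure ι) := by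
  have hR1 : 1 < R := lt_of_lt_of_le (by have := Real.exp_one_gt_d9; linarith) hR
  obtain ⟨C, -, hC⟩ := exists_norm_prod_eulerFactor_le G
  have hB := hC R hR
  have hlim := tendsto_integral_prod_eulerFactor_full G hs hsupp R hB
    (fun η => tendsto_prod_eulerFactor G R w η hR1 hW hw hw1)
  -- the integrals equal the sums, which are eventually constant
  have heq : ∀ Q : ℕ, ∫ η, (∏ i, phiF χ (η i)) * ∏ p ∈ Q.primesBelow, eulerFactor G p (zVec R η)
      ∂(fullMeasure ι) = ∑ d ∈ Fintype.piFinset (fun _ : ι => squarefreeOf Q.primesBelow),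
        (∏ p ∈ Q.primesBelow, (G.g p (pattern d p) : ℂ)) *
          ((∏ i, (ArithmeticFunction.moebius (d i) : ℂ)) * ∏ i, ((χ (Real.log (d i) / Real.log R) : ℝ) : ℂ)) :=
    fun Q => (sum_coef_prod_chi_eq_integral G hs hsupp hR1 fun p hp => (Nat.mem_primesBelow.1 hp).2).symm
  have hlim' : Tendsto (fun Q : ℕ => ∑ d ∈ Fintype.piFinset (fun _ : ι => squarefreeOf Q.primesBelow),
      (∏ p ∈ Q.primesBelow, (G.g p (pattern d p) : ℂ)) *
        ((∏ i, (ArithmeticFunction.moebius (d i) : ℂ)) * ∏ i, ((χ (Real.log (d i) / Real.log R) : ℝ) : ℂ)))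
      atTop (𝓝 _) := hlim.congr heq
  have hconst' : Tendsto (fun Q : ℕ => ∑ d ∈ Fintype.piFinset (fun _ : ι => squarefreeOf Q.primesBelow),
      (∏ p ∈ Q.primesBelow, (G.g p (pattern d p) : ℂ)) *
        ((∏ i, (ArithmeticFunction.moebius (d i) : ℂ)) * ∏ i, ((χ (Real.log (d i) / Real.log R) : ℝ) : ℂ)))
      atTop (𝓝 (∑ d ∈ Fintype.piFinset (fun _ : ι => squarefreeOf Q₀.primesBelow),
        (∏ p ∈ Q₀.primesBelow, (G.g p (pattern d p) : ℂ)) *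
          ((∏ i, (ArithmeticFunction.moebius (d i) : ℂ)) *
            ∏ i, ((χ (Real.log (d i) / Real.log R) : ℝ) : ℂ)))) :=
    tendsto_const_nhds.congr' (by
      filter_upwards [eventually_ge_atTop Q₀] with Q hQ
      exact (hconst Q hQ).symm)
  exact tendsto_nhds_unique hconst' hlim'

end integral

end Literature.NumberTheory.Sieve.SharpGY
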